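import Summits.QuantumFields.YangMills.Theorems.Instrument.BesselCapWidthOne
import Summits.QuantumFields.GaugeBoot.HankelDominanceCap
import Summits.QuantumFields.GaugeBoot.WilsonLoopLimitMonotone
import HarnessLib

/-!
# YM instrument cell — `SU(2)`, `D = 4`: the CAPPED Hausdorff-moment step at infinite-volume LIMIT POINTS
# (hdcap site/link blocks `[λ_m g_m(a+b+ε) − g_m(a+b+ε+1)] ⪰ 0` and mono-cap rows `g_m(t+1) ≤ λ_m g_m(t)`;
# `λ₁ = ρ`, `λ_{m ≥ 2} = ρ²`)

Cell `ym-instrument` (HUMAN RULING D-0084 (2); director-ym R138; HOME `run/shared/lean/pub/ym-instrument/`), crew (a),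
Lean typist seat `ym-instrument-boot-lean-1` (gen 3). Question Q-A1, amendment A-plan-11 «BESSEL CAP», class-LIMIT
COROLLARY of boot-plan AMEND A-plan-10 §1 / A-plan-11 v2 §1 (B2) (boot-ref LIMIT-SOUNDNESS P.5 / P.5-a): «under
hBesselCap(ρ), supp μ_R ⊂ [0, λ_R], λ₁ = ρ, λ_R = ρ² (R ≥ 2) ⇒ the shifted difference-Hankel form is PSD at every
class-LIMIT point» and «f_R(t+1) ≤ λ_R f_R(t)» — the `hdcap/R·/D0cap`, `hdcap/R·/D1cap` blocks and `hdcap/R·/mono` rows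
of the «LIMIT | cap» certificate files (cert-1 META v0.2). Ladder consequence: provenance of the «LIMIT | cap» rows of
TABLE-A1 (IR `stmt-QuantumFields-19354`, THE NUMBER); boot-plan ACT-D (T-a) «Hausdorff-moment step for capped blocks at
LIMIT points typed». No number, read or verdict of Q-A1 moves (answer of record «NO — capped at R1 (+cap)», A-0826-42).

HONEST FRAMING (page 1 of every file of this cell): WHAT IS CERTIFIED HERE, AT WHICH `(G, D, L, β)`: `G = SU(2)`
(fundamental, standard Wilson action, tree coupling `β/2`), `D = 4`, class LIMIT = infinite-volume limit points `μ` of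
the torus Wilson states along strictly increasing sequences of EVEN tori `(ℤ/(L_k+1))⁴` (NOT a finite-torus statement:
on a fixed torus the Hankel families wrap around), `β_std ∈ {9/5, 2, 11/5, 12/5}` hypothesis-free with the rational
`ρ(β)` of record (`2177/2500, 2207/2500, 558/625, 9013/10000`; `λ_{m≥2} = ρ²`, e.g. `4739329/6250000` at `9/5`) and
general `β > 0` under the point hypothesis `I₂(6β)/I₁(6β) ≤ ρ`. Writing `g_m(t) := ∫ W̄(t × m) dμ` (plane `(0, j)`,
`t` links along axis `0`, origin; tree observable `wilsonLoopObs (normalisedCharacter 2 ∘ suRep 2) (rectWalk 0 0 j t m)`):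
for every finite `S ⊂ ℕ` and real `c`, (D0cap) `0 ≤ Σ_{a,b∈S} c_a c_b (λ_m g_m(a+b) − g_m(a+b+1))`, (D1cap)
`0 ≤ Σ_{a,b∈S} c_a c_b (λ_m g_m(a+b+1) − g_m(a+b+2))`, (mono-cap) `g_m(t+1) ≤ λ_m g_m(t)` for every `t`, with `λ_m = ρ`
for every `m ≥ 1` and `λ_m = ρ²` for every `m ≥ 2`. INPUTS, all tree theorems: the limit Hankel families
`WilsonLoopLimit.wilsonLoop_integral_limit_gram_even/_odd` (torus RP Gram inequalities passed to the limit), the typed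
Bessel caps `BesselCapLimit.abs_integral_limit_wilsonLoop_le_pow_fst` (`ρ^{2t}`, `m ≥ 2`) and
`BesselCapWidthOne.abs_integral_limit_wilsonLoop_le_pow_left` (`ρ^t`, `m ≥ 1`), and the pure-math capped root trick
`Hankel.abs_hankel_shift_le_mul` (`GaugeBoot/HankelDominanceCap`). The Hausdorff-moment REPRESENTATION is NOT formalised
(as in `WilsonLoopLimitMonotone`); these blocks are its full finite content. Fixed coupling; NOT an area law, NOT a string
tension, NOT a mass gap, no continuum statement, no uniqueness of the limit; nothing summit-bearing; no hypothesis is left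
to the reader in the per-`β` theorems. The certificate→limit-point BIND of a class-LIMIT row (its variables as limits of
torus expectations) is NOT in this file.
-/

noncomputable section

namespace Summit.QuantumFields.YangMills.Theorems.Instrument

open MeasureTheory Filter Topology Finset
open Summit.QuantumFields.GaugeBoot
open Summit.QuantumFields.GaugeBoot.WilsonLoopLimit
open Summit.QuantumFields.GaugeBoot.Hankel
open Literature.MathematicalPhysics.QuantumFieldTheory
open Literature.MathematicalPhysics.QuantumLattice (LGConfig IsInfiniteVolumeLimitAlong wilsonLoopObs rectWalk
  normalisedCharacter)
open Literature.Analysis.FunctionSpaces (besselI)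

/-! ## The abstract step: a geometric cap on `g_m` gives the capped blocks (any `SU(N)`, any `D`) -/

section General

variable {D N : ℕ} [NeZero D]

/-- **Capped Hausdorff-moment step, abstract form.** At a limit point `μ` of the `SU(N)` torus Wilson states along even
tori at coupling `β/N ≥ 0`, if `g_m(t) = ∫ W̄(t × m) dμ` obeys `|g_m(t)| ≤ λ^t` for every `t` (`λ > 0`), then every SITE
capped difference-Hankel block `[λ g_m(a+b) − g_m(a+b+1)]_{a,b∈S}` and every LINK block
`[λ g_m(a+b+1) − g_m(a+b+2)]_{a,b∈S}` is positive semidefinite, and `g_m(t+1) ≤ λ g_m(t)` for every `t`.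
LIMIT POINTS ONLY. [folklore] -/
theorem limit_hankelCap_of_abs_le_pow {β : ℝ} (hβ : 0 ≤ β) {Lk : ℕ → ℕ} (hmono : StrictMono Lk)
    (heven : ∀ k, Even (Lk k + 1)) {μ : Measure (LGConfig D (SU N))}
    (hμ : IsInfiniteVolumeLimitAlong (suRep N) (β / N) Lk μ) {j : Fin D} (hj : j ≠ 0) (m : ℕ) {q : ℝ} (hq : 0 < q)
    (hcap : ∀ t : ℕ, |∫ U, wilsonLoopObs (normalisedCharacter N ∘ suRep N)
        (rectWalk (0 : Literature.Probability.LatticeModels.Site D) 0 j t m) U ∂μ| ≤ q ^ t) :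
    (∀ (S : Finset ℕ) (c : ℕ → ℝ), 0 ≤ ∑ a ∈ S, ∑ b ∈ S, c a * c b *
        (q * (∫ U, wilsonLoopObs (normalisedCharacter N ∘ suRep N)
            (rectWalk (0 : Literature.Probability.LatticeModels.Site D) 0 j (a + b) m) U ∂μ) -
          ∫ U, wilsonLoopObs (normalisedCharacter N ∘ suRep N)
            (rectWalk (0 : Literature.Probability.LatticeModels.Site D) 0 j (a + b + 1) m) U ∂μ)) ∧
    (∀ (S : Finset ℕ) (c : ℕ → ℝ), 0 ≤ ∑ a ∈ S, ∑ b ∈ S, c a * c b *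
        (q * (∫ U, wilsonLoopObs (normalisedCharacter N ∘ suRep N)
            (rectWalk (0 : Literature.Probability.LatticeModels.Site D) 0 j (a + b + 1) m) U ∂μ) -
          ∫ U, wilsonLoopObs (normalisedCharacter N ∘ suRep N)
            (rectWalk (0 : Literature.Probability.LatticeModels.Site D) 0 j (a + b + 2) m) U ∂μ)) ∧
    (∀ t : ℕ, (∫ U, wilsonLoopObs (normalisedCharacter N ∘ suRep N)
          (rectWalk (0 : Literature.Probability.LatticeModels.Site D) 0 j (t + 1) m) U ∂μ) ≤
        q * ∫ U, wilsonLoopObs (normalisedCharacter N ∘ suRep N)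
          (rectWalk (0 : Literature.Probability.LatticeModels.Site D) 0 j t m) U ∂μ) := by
  let f : ℕ → ℝ := fun t =>
    ∫ U, wilsonLoopObs (normalisedCharacter N ∘ suRep N)
      (rectWalk (0 : Literature.Probability.LatticeModels.Site D) 0 j t m) U ∂μ
  have hb : ∀ t, |f t| ≤ 1 * q ^ t := fun t => by rw [one_mul]; exact hcap t
  have hp : ∀ (S : Finset ℕ) (c : ℕ → ℝ), 0 ≤ ∑ a ∈ S, ∑ b ∈ S, c a * c b * f (a + b) :=
    fun S c => wilsonLoop_integral_limit_gram_even hmono heven hμ hj m S c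
  have hl : ∀ (S : Finset ℕ) (c : ℕ → ℝ), 0 ≤ ∑ a ∈ S, ∑ b ∈ S, c a * c b * f (a + b + 1) :=
    fun S c => wilsonLoop_integral_limit_gram_odd hβ hmono heven hμ hj m S c
  exact ⟨fun S c => hankel_cap_sub_shift_nonneg f hq hb hp S c,
    fun S c => hankel_cap_sub_shift_nonneg_succ f hq hb hl S c,
    fun t => succ_le_mul_of_hankel_cap f hq hb hp hl t⟩

end General

/-! ## `SU(2)`, `D = 4`, general `β > 0` under the point hypothesis `I₂(6β)/I₁(6β) ≤ ρ` -/

/-- **Capped blocks with `λ = ρ`, every width `m ≥ 1`** (one-sided cap `|g_m(t)| ≤ ρ^t`, file `BesselCapWidthOne`):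
site block, link block and mono-cap, at every limit point along even tori. [folklore] -/
theorem limit_hankelCap_one_of_besselRatio_le {β ρ : ℝ} (hβ : 0 < β) (hρ0 : 0 < ρ)
    (hρ : besselI 2 (6 * β) / besselI 1 (6 * β) ≤ ρ) {Lk : ℕ → ℕ} (hmono : StrictMono Lk)
    (heven : ∀ k, Even (Lk k + 1)) {μ : Measure (LGConfig 4 (SU 2))}
    (hμ : IsInfiniteVolumeLimitAlong (suRep 2) (β / (2 : ℕ)) Lk μ) {j : Fin 4} (hj : j ≠ 0) {m : ℕ} (hm : 1 ≤ m) :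
    (∀ (S : Finset ℕ) (c : ℕ → ℝ), 0 ≤ ∑ a ∈ S, ∑ b ∈ S, c a * c b *
        (ρ * (∫ U, wilsonLoopObs (normalisedCharacter 2 ∘ suRep 2)
            (rectWalk (0 : Literature.Probability.LatticeModels.Site 4) 0 j (a + b) m) U ∂μ) -
          ∫ U, wilsonLoopObs (normalisedCharacter 2 ∘ suRep 2)
            (rectWalk (0 : Literature.Probability.LatticeModels.Site 4) 0 j (a + b + 1) m) U ∂μ)) ∧
    (∀ (S : Finset ℕ) (c : ℕ → ℝ), 0 ≤ ∑ a ∈ S, ∑ b ∈ S, c a * c b *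
        (ρ * (∫ U, wilsonLoopObs (normalisedCharacter 2 ∘ suRep 2)
            (rectWalk (0 : Literature.Probability.LatticeModels.Site 4) 0 j (a + b + 1) m) U ∂μ) -
          ∫ U, wilsonLoopObs (normalisedCharacter 2 ∘ suRep 2)
            (rectWalk (0 : Literature.Probability.LatticeModels.Site 4) 0 j (a + b + 2) m) U ∂μ)) ∧
    (∀ t : ℕ, (∫ U, wilsonLoopObs (normalisedCharacter 2 ∘ suRep 2)
          (rectWalk (0 : Literature.Probability.LatticeModels.Site 4) 0 j (t + 1) m) U ∂μ) ≤
        ρ * ∫ U, wilsonLoopObs (normalisedCharacter 2 ∘ suRep 2)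
          (rectWalk (0 : Literature.Probability.LatticeModels.Site 4) 0 j t m) U ∂μ) :=
  limit_hankelCap_of_abs_le_pow hβ.le hmono heven hμ hj m hρ0 fun _ =>
    abs_integral_limit_wilsonLoop_le_pow_left hβ hρ0.le hρ hm hmono hμ 0 hj.symm

/-- **Capped blocks with `λ = ρ²`, every width `m ≥ 2`** (two-sided cap `|g_m(t)| ≤ ρ^{2t}`, file `BesselCapLimit`):
site block, link block and mono-cap, at every limit point along even tori. [folklore] -/
theorem limit_hankelCap_sq_of_besselRatio_le {β ρ : ℝ} (hβ : 0 < β) (hρ0 : 0 < ρ)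
    (hρ : besselI 2 (6 * β) / besselI 1 (6 * β) ≤ ρ) {Lk : ℕ → ℕ} (hmono : StrictMono Lk)
    (heven : ∀ k, Even (Lk k + 1)) {μ : Measure (LGConfig 4 (SU 2))}
    (hμ : IsInfiniteVolumeLimitAlong (suRep 2) (β / (2 : ℕ)) Lk μ) {j : Fin 4} (hj : j ≠ 0) {m : ℕ} (hm : 2 ≤ m) :
    (∀ (S : Finset ℕ) (c : ℕ → ℝ), 0 ≤ ∑ a ∈ S, ∑ b ∈ S, c a * c b *
        (ρ ^ 2 * (∫ U, wilsonLoopObs (normalisedCharacter 2 ∘ suRep 2)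
            (rectWalk (0 : Literature.Probability.LatticeModels.Site 4) 0 j (a + b) m) U ∂μ) -
          ∫ U, wilsonLoopObs (normalisedCharacter 2 ∘ suRep 2)
            (rectWalk (0 : Literature.Probability.LatticeModels.Site 4) 0 j (a + b + 1) m) U ∂μ)) ∧
    (∀ (S : Finset ℕ) (c : ℕ → ℝ), 0 ≤ ∑ a ∈ S, ∑ b ∈ S, c a * c b *
        (ρ ^ 2 * (∫ U, wilsonLoopObs (normalisedCharacter 2 ∘ suRep 2)
            (rectWalk (0 : Literature.Probability.LatticeModels.Site 4) 0 j (a + b + 1) m) U ∂μ) -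
          ∫ U, wilsonLoopObs (normalisedCharacter 2 ∘ suRep 2)
            (rectWalk (0 : Literature.Probability.LatticeModels.Site 4) 0 j (a + b + 2) m) U ∂μ)) ∧
    (∀ t : ℕ, (∫ U, wilsonLoopObs (normalisedCharacter 2 ∘ suRep 2)
          (rectWalk (0 : Literature.Probability.LatticeModels.Site 4) 0 j (t + 1) m) U ∂μ) ≤
        ρ ^ 2 * ∫ U, wilsonLoopObs (normalisedCharacter 2 ∘ suRep 2)
          (rectWalk (0 : Literature.Probability.LatticeModels.Site 4) 0 j t m) U ∂μ) :=
  limit_hankelCap_of_abs_le_pow hβ.le hmono heven hμ hj m (pow_pos hρ0 2) fun t => by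
    rw [← pow_mul]
    exact abs_integral_limit_wilsonLoop_le_pow_fst hβ hρ0.le hρ hm hmono hμ 0 hj.symm

/-! ## The hypothesis-free rows at the Q-A1 couplings

For each `β_std ∈ {9/5, 2, 11/5, 12/5}` and each cap class (`λ = ρ`, all `m ≥ 1`; `λ = ρ²`, all `m ≥ 2`): the SITE block
(`hdcap/R{m}/D0cap{S}`), the LINK block (`hdcap/R{m}/D1cap{S}`) and the mono-cap row (`hdcap/R{m}/mono t`) of the
«LIMIT | cap» files, for EVERY finite `S`, EVERY `t`, every limit point along even tori, every spatial axis `j ≠ 0`. -/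


/-- `gLim μ j m t := ∫ W̄(t × m) dμ` — the rectangle expectation at a limit point `μ` (`SU(2)`, `D = 4`), plane `(0, j)`,
`t` links along axis `0`, width `m`, base point the origin: the `g_m(t)` of `GaugeBoot/WilsonLoopLimitMonotone`, i.e.
`∫ U, wilsonLoopObs (normalisedCharacter 2 ∘ suRep 2) (rectWalk 0 0 j t m) U ∂μ` (`gLim_eq`, `rfl`). [folklore] -/
def gLim (μ : Measure (LGConfig 4 (SU 2))) (j : Fin 4) (m t : ℕ) : ℝ :=
  ∫ U, wilsonLoopObs (normalisedCharacter 2 ∘ suRep 2)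
    (rectWalk (0 : Literature.Probability.LatticeModels.Site 4) 0 j t m) U ∂μ

/-- Unfolding `gLim` (by `rfl`). [folklore] -/
theorem gLim_eq (μ : Measure (LGConfig 4 (SU 2))) (j : Fin 4) (m t : ℕ) : gLim μ j m t =
    ∫ U, wilsonLoopObs (normalisedCharacter 2 ∘ suRep 2)
      (rectWalk (0 : Literature.Probability.LatticeModels.Site 4) 0 j t m) U ∂μ :=
  rfl

section B9o5

variable {Lk : ℕ → ℕ} {μ : Measure (LGConfig 4 (SU 2))} {j : Fin 4} {m : ℕ}

/-- **`β_std = 9/5`, `λ₁ = ρ = 2177/2500`, site block** `[ρ g_m(a+b) − g_m(a+b+1)]_{a,b∈S} ⪰ 0`, every `m ≥ 1`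
(row objects `hdcap/R1/D0cap{S}`). LIMIT POINTS along even tori ONLY. [folklore] -/
theorem limit_hdcap_site_one_b9o5 (hmono : StrictMono Lk) (heven : ∀ k, Even (Lk k + 1))
    (hμ : IsInfiniteVolumeLimitAlong (suRep 2) ((9 / 5 : ℝ) / (2 : ℕ)) Lk μ) (hj : j ≠ 0) (hm : 1 ≤ m)
    (S : Finset ℕ) (c : ℕ → ℝ) :
    0 ≤ ∑ a ∈ S, ∑ b ∈ S, c a * c b * ((2177 / 2500 : ℝ) * gLim μ j m (a + b) - gLim μ j m (a + b + 1)) :=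
  (limit_hankelCap_one_of_besselRatio_le (by norm_num) (by norm_num) besselRatio_b9o5_le hmono heven hμ hj hm).1 S c

/-- **`β_std = 9/5`, `λ₁ = ρ`, link block** `[ρ g_m(a+b+1) − g_m(a+b+2)]_{a,b∈S} ⪰ 0`, every `m ≥ 1`
(`hdcap/R1/D1cap{S}`). [folklore] -/
theorem limit_hdcap_link_one_b9o5 (hmono : StrictMono Lk) (heven : ∀ k, Even (Lk k + 1))
    (hμ : IsInfiniteVolumeLimitAlong (suRep 2) ((9 / 5 : ℝ) / (2 : ℕ)) Lk μ) (hj : j ≠ 0) (hm : 1 ≤ m)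
    (S : Finset ℕ) (c : ℕ → ℝ) :
    0 ≤ ∑ a ∈ S, ∑ b ∈ S, c a * c b * ((2177 / 2500 : ℝ) * gLim μ j m (a + b + 1) - gLim μ j m (a + b + 2)) :=
  (limit_hankelCap_one_of_besselRatio_le (by norm_num) (by norm_num) besselRatio_b9o5_le hmono heven hμ hj hm).2.1 S c

/-- **`β_std = 9/5`, `λ₁ = ρ`, mono-cap** `g_m(t+1) ≤ ρ g_m(t)`, every `m ≥ 1`, every `t` (`hdcap/R1/mono t`). [folklore] -/
theorem limit_monocap_one_b9o5 (hmono : StrictMono Lk) (heven : ∀ k, Even (Lk k + 1))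
    (hμ : IsInfiniteVolumeLimitAlong (suRep 2) ((9 / 5 : ℝ) / (2 : ℕ)) Lk μ) (hj : j ≠ 0) (hm : 1 ≤ m) (t : ℕ) :
    gLim μ j m (t + 1) ≤ (2177 / 2500 : ℝ) * gLim μ j m t :=
  (limit_hankelCap_one_of_besselRatio_le (by norm_num) (by norm_num) besselRatio_b9o5_le hmono heven hμ hj hm).2.2 t

/-- **`β_std = 9/5`, `λ_m = ρ² = 4739329/6250000` (`m ≥ 2`), site block** `[ρ² g_m(a+b) − g_m(a+b+1)]_{a,b∈S} ⪰ 0`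
(`hdcap/R{m}/D0cap{S}`, `m ≥ 2`). [folklore] -/
theorem limit_hdcap_site_sq_b9o5 (hmono : StrictMono Lk) (heven : ∀ k, Even (Lk k + 1))
    (hμ : IsInfiniteVolumeLimitAlong (suRep 2) ((9 / 5 : ℝ) / (2 : ℕ)) Lk μ) (hj : j ≠ 0) (hm : 2 ≤ m)
    (S : Finset ℕ) (c : ℕ → ℝ) :
    0 ≤ ∑ a ∈ S, ∑ b ∈ S, c a * c b * ((2177 / 2500 : ℝ) ^ 2 * gLim μ j m (a + b) - gLim μ j m (a + b + 1)) :=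
  (limit_hankelCap_sq_of_besselRatio_le (by norm_num) (by norm_num) besselRatio_b9o5_le hmono heven hμ hj hm).1 S c

/-- **`β_std = 9/5`, `λ_m = ρ²` (`m ≥ 2`), link block** `[ρ² g_m(a+b+1) − g_m(a+b+2)]_{a,b∈S} ⪰ 0`
(`hdcap/R{m}/D1cap{S}`, `m ≥ 2`). [folklore] -/
theorem limit_hdcap_link_sq_b9o5 (hmono : StrictMono Lk) (heven : ∀ k, Even (Lk k + 1))
    (hμ : IsInfiniteVolumeLimitAlong (suRep 2) ((9 / 5 : ℝ) / (2 : ℕ)) Lk μ) (hj : j ≠ 0) (hm : 2 ≤ m)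
    (S : Finset ℕ) (c : ℕ → ℝ) :
    0 ≤ ∑ a ∈ S, ∑ b ∈ S, c a * c b * ((2177 / 2500 : ℝ) ^ 2 * gLim μ j m (a + b + 1) - gLim μ j m (a + b + 2)) :=
  (limit_hankelCap_sq_of_besselRatio_le (by norm_num) (by norm_num) besselRatio_b9o5_le hmono heven hμ hj hm).2.1 S c

/-- **`β_std = 9/5`, `λ_m = ρ²` (`m ≥ 2`), mono-cap** `g_m(t+1) ≤ ρ² g_m(t)`, every `t` (`hdcap/R{m}/mono t`, `m ≥ 2`).
[folklore] -/
theorem limit_monocap_sq_b9o5 (hmono : StrictMono Lk) (heven : ∀ k, Even (Lk k + 1))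
    (hμ : IsInfiniteVolumeLimitAlong (suRep 2) ((9 / 5 : ℝ) / (2 : ℕ)) Lk μ) (hj : j ≠ 0) (hm : 2 ≤ m) (t : ℕ) :
    gLim μ j m (t + 1) ≤ (2177 / 2500 : ℝ) ^ 2 * gLim μ j m t :=
  (limit_hankelCap_sq_of_besselRatio_le (by norm_num) (by norm_num) besselRatio_b9o5_le hmono heven hμ hj hm).2.2 t

end B9o5

section B2

variable {Lk : ℕ → ℕ} {μ : Measure (LGConfig 4 (SU 2))} {j : Fin 4} {m : ℕ}

/-- **`β_std = 2`, `λ₁ = ρ = 2207/2500`, site block** `[ρ g_m(a+b) − g_m(a+b+1)]_{a,b∈S} ⪰ 0`, every `m ≥ 1`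
(row objects `hdcap/R1/D0cap{S}`). LIMIT POINTS along even tori ONLY. [folklore] -/
theorem limit_hdcap_site_one_b2 (hmono : StrictMono Lk) (heven : ∀ k, Even (Lk k + 1))
    (hμ : IsInfiniteVolumeLimitAlong (suRep 2) ((2 : ℝ) / (2 : ℕ)) Lk μ) (hj : j ≠ 0) (hm : 1 ≤ m)
    (S : Finset ℕ) (c : ℕ → ℝ) :
    0 ≤ ∑ a ∈ S, ∑ b ∈ S, c a * c b * ((2207 / 2500 : ℝ) * gLim μ j m (a + b) - gLim μ j m (a + b + 1)) :=
  (limit_hankelCap_one_of_besselRatio_le (by norm_num) (by norm_num) besselRatio_b2_le hmono heven hμ hj hm).1 S c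

/-- **`β_std = 2`, `λ₁ = ρ`, link block** `[ρ g_m(a+b+1) − g_m(a+b+2)]_{a,b∈S} ⪰ 0`, every `m ≥ 1`
(`hdcap/R1/D1cap{S}`). [folklore] -/
theorem limit_hdcap_link_one_b2 (hmono : StrictMono Lk) (heven : ∀ k, Even (Lk k + 1))
    (hμ : IsInfiniteVolumeLimitAlong (suRep 2) ((2 : ℝ) / (2 : ℕ)) Lk μ) (hj : j ≠ 0) (hm : 1 ≤ m)
    (S : Finset ℕ) (c : ℕ → ℝ) :
    0 ≤ ∑ a ∈ S, ∑ b ∈ S, c a * c b * ((2207 / 2500 : ℝ) * gLim μ j m (a + b + 1) - gLim μ j m (a + b + 2)) :=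
  (limit_hankelCap_one_of_besselRatio_le (by norm_num) (by norm_num) besselRatio_b2_le hmono heven hμ hj hm).2.1 S c

/-- **`β_std = 2`, `λ₁ = ρ`, mono-cap** `g_m(t+1) ≤ ρ g_m(t)`, every `m ≥ 1`, every `t` (`hdcap/R1/mono t`). [folklore] -/
theorem limit_monocap_one_b2 (hmono : StrictMono Lk) (heven : ∀ k, Even (Lk k + 1))
    (hμ : IsInfiniteVolumeLimitAlong (suRep 2) ((2 : ℝ) / (2 : ℕ)) Lk μ) (hj : j ≠ 0) (hm : 1 ≤ m) (t : ℕ) :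
    gLim μ j m (t + 1) ≤ (2207 / 2500 : ℝ) * gLim μ j m t :=
  (limit_hankelCap_one_of_besselRatio_le (by norm_num) (by norm_num) besselRatio_b2_le hmono heven hμ hj hm).2.2 t

/-- **`β_std = 2`, `λ_m = ρ² = 4870849/6250000` (`m ≥ 2`), site block** `[ρ² g_m(a+b) − g_m(a+b+1)]_{a,b∈S} ⪰ 0`
(`hdcap/R{m}/D0cap{S}`, `m ≥ 2`). [folklore] -/
theorem limit_hdcap_site_sq_b2 (hmono : StrictMono Lk) (heven : ∀ k, Even (Lk k + 1))
    (hμ : IsInfiniteVolumeLimitAlong (suRep 2) ((2 : ℝ) / (2 : ℕ)) Lk μ) (hj : j ≠ 0) (hm : 2 ≤ m)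
    (S : Finset ℕ) (c : ℕ → ℝ) :
    0 ≤ ∑ a ∈ S, ∑ b ∈ S, c a * c b * ((2207 / 2500 : ℝ) ^ 2 * gLim μ j m (a + b) - gLim μ j m (a + b + 1)) :=
  (limit_hankelCap_sq_of_besselRatio_le (by norm_num) (by norm_num) besselRatio_b2_le hmono heven hμ hj hm).1 S c

/-- **`β_std = 2`, `λ_m = ρ²` (`m ≥ 2`), link block** `[ρ² g_m(a+b+1) − g_m(a+b+2)]_{a,b∈S} ⪰ 0`
(`hdcap/R{m}/D1cap{S}`, `m ≥ 2`). [folklore] -/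
theorem limit_hdcap_link_sq_b2 (hmono : StrictMono Lk) (heven : ∀ k, Even (Lk k + 1))
    (hμ : IsInfiniteVolumeLimitAlong (suRep 2) ((2 : ℝ) / (2 : ℕ)) Lk μ) (hj : j ≠ 0) (hm : 2 ≤ m)
    (S : Finset ℕ) (c : ℕ → ℝ) :
    0 ≤ ∑ a ∈ S, ∑ b ∈ S, c a * c b * ((2207 / 2500 : ℝ) ^ 2 * gLim μ j m (a + b + 1) - gLim μ j m (a + b + 2)) :=
  (limit_hankelCap_sq_of_besselRatio_le (by norm_num) (by norm_num) besselRatio_b2_le hmono heven hμ hj hm).2.1 S c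

/-- **`β_std = 2`, `λ_m = ρ²` (`m ≥ 2`), mono-cap** `g_m(t+1) ≤ ρ² g_m(t)`, every `t` (`hdcap/R{m}/mono t`, `m ≥ 2`).
[folklore] -/
theorem limit_monocap_sq_b2 (hmono : StrictMono Lk) (heven : ∀ k, Even (Lk k + 1))
    (hμ : IsInfiniteVolumeLimitAlong (suRep 2) ((2 : ℝ) / (2 : ℕ)) Lk μ) (hj : j ≠ 0) (hm : 2 ≤ m) (t : ℕ) :
    gLim μ j m (t + 1) ≤ (2207 / 2500 : ℝ) ^ 2 * gLim μ j m t :=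
  (limit_hankelCap_sq_of_besselRatio_le (by norm_num) (by norm_num) besselRatio_b2_le hmono heven hμ hj hm).2.2 t

end B2

section B11o5

variable {Lk : ℕ → ℕ} {μ : Measure (LGConfig 4 (SU 2))} {j : Fin 4} {m : ℕ}

/-- **`β_std = 11/5`, `λ₁ = ρ = 558/625`, site block** `[ρ g_m(a+b) − g_m(a+b+1)]_{a,b∈S} ⪰ 0`, every `m ≥ 1`
(row objects `hdcap/R1/D0cap{S}`). LIMIT POINTS along even tori ONLY. [folklore] -/
theorem limit_hdcap_site_one_b11o5 (hmono : StrictMono Lk) (heven : ∀ k, Even (Lk k + 1))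
    (hμ : IsInfiniteVolumeLimitAlong (suRep 2) ((11 / 5 : ℝ) / (2 : ℕ)) Lk μ) (hj : j ≠ 0) (hm : 1 ≤ m)
    (S : Finset ℕ) (c : ℕ → ℝ) :
    0 ≤ ∑ a ∈ S, ∑ b ∈ S, c a * c b * ((558 / 625 : ℝ) * gLim μ j m (a + b) - gLim μ j m (a + b + 1)) :=
  (limit_hankelCap_one_of_besselRatio_le (by norm_num) (by norm_num) besselRatio_b11o5_le hmono heven hμ hj hm).1 S c

/-- **`β_std = 11/5`, `λ₁ = ρ`, link block** `[ρ g_m(a+b+1) − g_m(a+b+2)]_{a,b∈S} ⪰ 0`, every `m ≥ 1`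
(`hdcap/R1/D1cap{S}`). [folklore] -/
theorem limit_hdcap_link_one_b11o5 (hmono : StrictMono Lk) (heven : ∀ k, Even (Lk k + 1))
    (hμ : IsInfiniteVolumeLimitAlong (suRep 2) ((11 / 5 : ℝ) / (2 : ℕ)) Lk μ) (hj : j ≠ 0) (hm : 1 ≤ m)
    (S : Finset ℕ) (c : ℕ → ℝ) :
    0 ≤ ∑ a ∈ S, ∑ b ∈ S, c a * c b * ((558 / 625 : ℝ) * gLim μ j m (a + b + 1) - gLim μ j m (a + b + 2)) :=
  (limit_hankelCap_one_of_besselRatio_le (by norm_num) (by norm_num) besselRatio_b11o5_le hmono heven hμ hj hm).2.1 S c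

/-- **`β_std = 11/5`, `λ₁ = ρ`, mono-cap** `g_m(t+1) ≤ ρ g_m(t)`, every `m ≥ 1`, every `t` (`hdcap/R1/mono t`). [folklore] -/
theorem limit_monocap_one_b11o5 (hmono : StrictMono Lk) (heven : ∀ k, Even (Lk k + 1))
    (hμ : IsInfiniteVolumeLimitAlong (suRep 2) ((11 / 5 : ℝ) / (2 : ℕ)) Lk μ) (hj : j ≠ 0) (hm : 1 ≤ m) (t : ℕ) :
    gLim μ j m (t + 1) ≤ (558 / 625 : ℝ) * gLim μ j m t :=
  (limit_hankelCap_one_of_besselRatio_le (by norm_num) (by norm_num) besselRatio_b11o5_le hmono heven hμ hj hm).2.2 t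

/-- **`β_std = 11/5`, `λ_m = ρ² = 311364/390625` (`m ≥ 2`), site block** `[ρ² g_m(a+b) − g_m(a+b+1)]_{a,b∈S} ⪰ 0`
(`hdcap/R{m}/D0cap{S}`, `m ≥ 2`). [folklore] -/
theorem limit_hdcap_site_sq_b11o5 (hmono : StrictMono Lk) (heven : ∀ k, Even (Lk k + 1))
    (hμ : IsInfiniteVolumeLimitAlong (suRep 2) ((11 / 5 : ℝ) / (2 : ℕ)) Lk μ) (hj : j ≠ 0) (hm : 2 ≤ m)
    (S : Finset ℕ) (c : ℕ → ℝ) :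
    0 ≤ ∑ a ∈ S, ∑ b ∈ S, c a * c b * ((558 / 625 : ℝ) ^ 2 * gLim μ j m (a + b) - gLim μ j m (a + b + 1)) :=
  (limit_hankelCap_sq_of_besselRatio_le (by norm_num) (by norm_num) besselRatio_b11o5_le hmono heven hμ hj hm).1 S c

/-- **`β_std = 11/5`, `λ_m = ρ²` (`m ≥ 2`), link block** `[ρ² g_m(a+b+1) − g_m(a+b+2)]_{a,b∈S} ⪰ 0`
(`hdcap/R{m}/D1cap{S}`, `m ≥ 2`). [folklore] -/
theorem limit_hdcap_link_sq_b11o5 (hmono : StrictMono Lk) (heven : ∀ k, Even (Lk k + 1))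
    (hμ : IsInfiniteVolumeLimitAlong (suRep 2) ((11 / 5 : ℝ) / (2 : ℕ)) Lk μ) (hj : j ≠ 0) (hm : 2 ≤ m)
    (S : Finset ℕ) (c : ℕ → ℝ) :
    0 ≤ ∑ a ∈ S, ∑ b ∈ S, c a * c b * ((558 / 625 : ℝ) ^ 2 * gLim μ j m (a + b + 1) - gLim μ j m (a + b + 2)) :=
  (limit_hankelCap_sq_of_besselRatio_le (by norm_num) (by norm_num) besselRatio_b11o5_le hmono heven hμ hj hm).2.1 S c

/-- **`β_std = 11/5`, `λ_m = ρ²` (`m ≥ 2`), mono-cap** `g_m(t+1) ≤ ρ² g_m(t)`, every `t` (`hdcap/R{m}/mono t`, `m ≥ 2`).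
[folklore] -/
theorem limit_monocap_sq_b11o5 (hmono : StrictMono Lk) (heven : ∀ k, Even (Lk k + 1))
    (hμ : IsInfiniteVolumeLimitAlong (suRep 2) ((11 / 5 : ℝ) / (2 : ℕ)) Lk μ) (hj : j ≠ 0) (hm : 2 ≤ m) (t : ℕ) :
    gLim μ j m (t + 1) ≤ (558 / 625 : ℝ) ^ 2 * gLim μ j m t :=
  (limit_hankelCap_sq_of_besselRatio_le (by norm_num) (by norm_num) besselRatio_b11o5_le hmono heven hμ hj hm).2.2 t

end B11o5

section B12o5

variable {Lk : ℕ → ℕ} {μ : Measure (LGConfig 4 (SU 2))} {j : Fin 4} {m : ℕ}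

/-- **`β_std = 12/5`, `λ₁ = ρ = 9013/10000`, site block** `[ρ g_m(a+b) − g_m(a+b+1)]_{a,b∈S} ⪰ 0`, every `m ≥ 1`
(row objects `hdcap/R1/D0cap{S}`). LIMIT POINTS along even tori ONLY. [folklore] -/
theorem limit_hdcap_site_one_b12o5 (hmono : StrictMono Lk) (heven : ∀ k, Even (Lk k + 1))
    (hμ : IsInfiniteVolumeLimitAlong (suRep 2) ((12 / 5 : ℝ) / (2 : ℕ)) Lk μ) (hj : j ≠ 0) (hm : 1 ≤ m)
    (S : Finset ℕ) (c : ℕ → ℝ) :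
    0 ≤ ∑ a ∈ S, ∑ b ∈ S, c a * c b * ((9013 / 10000 : ℝ) * gLim μ j m (a + b) - gLim μ j m (a + b + 1)) :=
  (limit_hankelCap_one_of_besselRatio_le (by norm_num) (by norm_num) besselRatio_b12o5_le hmono heven hμ hj hm).1 S c

/-- **`β_std = 12/5`, `λ₁ = ρ`, link block** `[ρ g_m(a+b+1) − g_m(a+b+2)]_{a,b∈S} ⪰ 0`, every `m ≥ 1`
(`hdcap/R1/D1cap{S}`). [folklore] -/
theorem limit_hdcap_link_one_b12o5 (hmono : StrictMono Lk) (heven : ∀ k, Even (Lk k + 1))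
    (hμ : IsInfiniteVolumeLimitAlong (suRep 2) ((12 / 5 : ℝ) / (2 : ℕ)) Lk μ) (hj : j ≠ 0) (hm : 1 ≤ m)
    (S : Finset ℕ) (c : ℕ → ℝ) :
    0 ≤ ∑ a ∈ S, ∑ b ∈ S, c a * c b * ((9013 / 10000 : ℝ) * gLim μ j m (a + b + 1) - gLim μ j m (a + b + 2)) :=
  (limit_hankelCap_one_of_besselRatio_le (by norm_num) (by norm_num) besselRatio_b12o5_le hmono heven hμ hj hm).2.1 S c

/-- **`β_std = 12/5`, `λ₁ = ρ`, mono-cap** `g_m(t+1) ≤ ρ g_m(t)`, every `m ≥ 1`, every `t` (`hdcap/R1/mono t`). [folklore] -/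
theorem limit_monocap_one_b12o5 (hmono : StrictMono Lk) (heven : ∀ k, Even (Lk k + 1))
    (hμ : IsInfiniteVolumeLimitAlong (suRep 2) ((12 / 5 : ℝ) / (2 : ℕ)) Lk μ) (hj : j ≠ 0) (hm : 1 ≤ m) (t : ℕ) :
    gLim μ j m (t + 1) ≤ (9013 / 10000 : ℝ) * gLim μ j m t :=
  (limit_hankelCap_one_of_besselRatio_le (by norm_num) (by norm_num) besselRatio_b12o5_le hmono heven hμ hj hm).2.2 t

/-- **`β_std = 12/5`, `λ_m = ρ² = 81234169/100000000` (`m ≥ 2`), site block** `[ρ² g_m(a+b) − g_m(a+b+1)]_{a,b∈S} ⪰ 0`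
(`hdcap/R{m}/D0cap{S}`, `m ≥ 2`). [folklore] -/
theorem limit_hdcap_site_sq_b12o5 (hmono : StrictMono Lk) (heven : ∀ k, Even (Lk k + 1))
    (hμ : IsInfiniteVolumeLimitAlong (suRep 2) ((12 / 5 : ℝ) / (2 : ℕ)) Lk μ) (hj : j ≠ 0) (hm : 2 ≤ m)
    (S : Finset ℕ) (c : ℕ → ℝ) :
    0 ≤ ∑ a ∈ S, ∑ b ∈ S, c a * c b * ((9013 / 10000 : ℝ) ^ 2 * gLim μ j m (a + b) - gLim μ j m (a + b + 1)) :=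
  (limit_hankelCap_sq_of_besselRatio_le (by norm_num) (by norm_num) besselRatio_b12o5_le hmono heven hμ hj hm).1 S c

/-- **`β_std = 12/5`, `λ_m = ρ²` (`m ≥ 2`), link block** `[ρ² g_m(a+b+1) − g_m(a+b+2)]_{a,b∈S} ⪰ 0`
(`hdcap/R{m}/D1cap{S}`, `m ≥ 2`). [folklore] -/
theorem limit_hdcap_link_sq_b12o5 (hmono : StrictMono Lk) (heven : ∀ k, Even (Lk k + 1))
    (hμ : IsInfiniteVolumeLimitAlong (suRep 2) ((12 / 5 : ℝ) / (2 : ℕ)) Lk μ) (hj : j ≠ 0) (hm : 2 ≤ m)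
    (S : Finset ℕ) (c : ℕ → ℝ) :
    0 ≤ ∑ a ∈ S, ∑ b ∈ S, c a * c b * ((9013 / 10000 : ℝ) ^ 2 * gLim μ j m (a + b + 1) - gLim μ j m (a + b + 2)) :=
  (limit_hankelCap_sq_of_besselRatio_le (by norm_num) (by norm_num) besselRatio_b12o5_le hmono heven hμ hj hm).2.1 S c

/-- **`β_std = 12/5`, `λ_m = ρ²` (`m ≥ 2`), mono-cap** `g_m(t+1) ≤ ρ² g_m(t)`, every `t` (`hdcap/R{m}/mono t`, `m ≥ 2`).
[folklore] -/
theorem limit_monocap_sq_b12o5 (hmono : StrictMono Lk) (heven : ∀ k, Even (Lk k + 1))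
    (hμ : IsInfiniteVolumeLimitAlong (suRep 2) ((12 / 5 : ℝ) / (2 : ℕ)) Lk μ) (hj : j ≠ 0) (hm : 2 ≤ m) (t : ℕ) :
    gLim μ j m (t + 1) ≤ (9013 / 10000 : ℝ) ^ 2 * gLim μ j m t :=
  (limit_hankelCap_sq_of_besselRatio_le (by norm_num) (by norm_num) besselRatio_b12o5_le hmono heven hμ hj hm).2.2 t

end B12o5

end Summit.QuantumFields.YangMills.Theorems.Instrument

end
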